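/-
Copyright (c) 2026 the pub-hodgecm-mathlib formalisation cell (harness21).  Prover seat hodgecm-mathlib-K2E5-p08 (g2), Track B «K2-LIT» ∕ h413,
engine E5 «TamagawaUnitary», unit G (ZETA), deal BATCH #8 (c) (ED. 2, part 2): WEAK APPROXIMATION FOR THE REDUCED-NORM IMAGE —
`𝕀_{L⁺} = L⁺ˣ · Nrd((D_h ⊗ 𝔸)^×)`.  2026-09-04.
-/
import Summits.HodgeConjecture.HodgeConjecture.Theorems.K2E5QuatAdelicSinglePlace           -- ★ (p855647, this seat): `⟨u⟩_{v₀} ⊗ 1 ∈ Nrd((D_h⊗𝔸)^×)`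
import Summits.HodgeConjecture.HodgeConjecture.Theorems.K2E5QuatAdelicNrdSurjectiveOpen    -- ★ ED. 1 (p855492, this seat): `normIdeles_le_comap_range_quatAdelicNrd`
import Literature.NumberTheory.Automorphic.QuadraticHeckeCharacterLocalComponent           -- ★ `localUnits_mem_principalIdeles_sup_normIdeles_iff` (O'Meara 71:18)
import Literature.NumberTheory.GaloisRepresentations.QuadraticIdeleNormResidueExact        -- ★ `mem_principalIdeles_sup_normIdeles_iff_even` (norm-residue exactness)
import Literature.NumberTheory.NumberFields.RealPlacesSignPrescription                     -- ★ `exists_forall_embedding_pos_iff` (prescribed signs at the real places)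
import Literature.NumberTheory.Rogawski1990.KottwitzSignTwistedFrameArch                   -- ★ `mem_quadraticNormSubgroup_completion_iff_pos` (local norms at a real place of L⁺)
import Literature.NumberTheory.QuadraticForms.HilbertSymbolArchimedean                     -- ★ `ringEquivRealOfIsReal_algebraMap`
import HarnessLib

/-!
# K2 ∕ E5 «TamagawaUnitary», unit G (ZETA), deal BATCH #8 (c), ED. 2 part 2 — `K2E5QuatNrdWeakApproximation`:
# **weak approximation for the reduced-norm image: `𝕀_{L⁺} = L⁺ˣ · Q⁺`**, `Q⁺ = Nrd((D_h ⊗ 𝔸)^×).comap(𝕀_{L⁺} → 𝕀_L)` —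
# every idèle of `L⁺` is a principal idèle times (the descent of) a global reduced norm from `(D_h ⊗ 𝔸)^×`

Cell `hodgecm-mathlib` (Track B «K2-LIT»), engine E5, item h413 = `stmt-HodgeConjecture-24833`; PROOF lane, helper file
(`--supports stmt-HodgeConjecture-24833 --as helper`; theorems only: no `def`, no instance, no notation, no named fact, no `sorry`);
deal BATCH #8 (c) of K2E5-plan (g0): «WEAK APPROXIMATION: every `t : ↥(fixedAdelicUnits L)` is (principal) · (element of `quatNrdImage L h`)» — the
h-FREENESS input of socket G6 `sig_K2E5NrdImageCovol` (`covol(Nrd-image¹ ∕ Nrd Γ_h) = covol(𝕀¹_{L⁺} ∕ L⁺ˣ)`); author K2E5-p08 (g2).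

THE MATHEMATICS — an index-two argument, NOT the full explicit image ([Omeara1963, §65D Prop. 65:21, §71 Thm. 71:18–19]; [VignerasLNM800, Ch. III §2 (proof of
Thm. 2.3), §4]; [CasselsFrohlichANT1967, Ch. VII §6 Thm. 6.3]).  Let `K = L⁺`, `L = K(√θ)` (★ `cmQuadraticGenerator`, totally negative, not a square), `P = Kˣ ≤ 𝕀_K`,
`N = normIdeles K θ = N_{L/K}(𝕀_L)`, `Q⁺` as above.
* `[𝕀_K : P·N] = 2` (★ `index_principalIdeles_sup_normIdeles` = O'Meara 65:21) and `N ≤ Q⁺` (★ ED. 1 `normIdeles_le_comap_range_quatAdelicNrd`), so `P·Q⁺ ⊇ P·N` has index `1` or `2`,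
  and `P·Q⁺ = 𝕀_K` as soon as `Q⁺ ⊄ P·N` (`sup_eq_top_of_index_two`).
* A WITNESS `q ∈ Q⁺ ∖ P·N`: there is a finite place `v₀` of `K` and a `c ∈ K_{v₀}ˣ` which is NOT a local norm from `L_w` (`exists_not_mem_quadraticNormSubgroup`): take `a ∈ K`
  negative at exactly one real place (★ `exists_forall_embedding_pos_iff`); the principal idèle `(a)` lies in `P·N`, so the number of places where `a` is not a local norm is EVEN
  (★ `mem_principalIdeles_sup_normIdeles_iff_even` = Hilbert reciprocity); exactly ONE infinite place is bad (★ `mem_quadraticNormSubgroup_completion_iff_pos`: at a real place of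
  `K` the local norms from `ℂ` are the positives), hence some finite place `v₀` is bad, `c = a ∈ K_{v₀}ˣ`.  Then the single-place idèle `q = ⟨c⟩_{v₀}` lies in `Q⁺`
  (★ `K2E5QuatAdelicSinglePlace.ideleBaseChange_localUnits_mem_range_quatAdelicNrd`: EVERY `⟨u⟩_{v₀}` is a reduced norm) but not in `P·N` (★ `localUnits_mem_principalIdeles_sup_normIdeles_iff`
  = O'Meara 71:18: `⟨c⟩_{v₀} ∈ P·N ↔ c` is a local norm).
* Hence **`P ⊔ Q⁺ = ⊤`** (`principalIdeles_sup_comap_range_quatAdelicNrd_eq_top`) and, read in `𝕀_L`, **every `t ∈ fixedAdelicUnits L` is `(a ⊗ 1) · Nrd(X)`** with `a ∈ L⁺ˣ`,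
  `X ∈ (D_h ⊗ 𝔸)^×` (`exists_principal_mul_quatAdelicNrd_eq`).

HONEST LABEL: HC_CM is proved only modulo the 7 printed citations (2 remaining named inputs: hLiu418 = stmt-HodgeConjecture-24832,
h413 = stmt-HodgeConjecture-24833) until rung 0 closes; this helper closes no socket and changes no count.

## References
* [Omeara1963] O. T. O'Meara, *Introduction to Quadratic Forms* (1963) — §65D Prop. 65:21, §71 Thm. 71:18, Thm. 71:19.
* [VignerasLNM800] M.-F. Vignéras, *Arithmétique des algèbres de quaternions*, LNM 800 (1980) — Ch. III §2 (proof of Thm. 2.3), §4 Thm. 4.1.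
* [CasselsFrohlichANT1967] J. W. S. Cassels, A. Fröhlich (eds.), *Algebraic Number Theory* (1967) — Ch. VII §6 Thm. 6.3; Ch. II §16.
* [PlatonovRapinchuk1994] V. Platonov, A. Rapinchuk, *Algebraic Groups and Number Theory* (1994) — §1.2 (weak approximation), §8.2.
-/

set_option autoImplicit false
set_option linter.dupNamespace false

noncomputable section

namespace Summit.HodgeConjecture.HodgeConjecture.Cruxes.H413.K2E5QuatNrdWeakApproximation

open NumberField IsDedekindDomain
open Literature.NumberTheory.Automorphic
open Literature.NumberTheory.GaloisRepresentations (ideleGroup principalIdeles localUnits mem_principalIdeles_sup_normIdeles_iff_even)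
open Literature.NumberTheory.QuadraticForms (normIdeles quadraticNormSubgroup ideleFiniteComponent ideleInfiniteComponent ideleFiniteComponent_principal
  ideleInfiniteComponent_principal ringEquivRealOfIsReal_algebraMap)
open Summit.HodgeConjecture.HodgeConjecture.Cruxes.H413.K2E5QuatAdelicMatrixModel
open Summit.HodgeConjecture.HodgeConjecture.Cruxes.H413.K2E5QuatAdelicNrd
open Summit.HodgeConjecture.HodgeConjecture.Cruxes.H413.K2E5QuatAdelicNrdSurjectiveOpen
open Summit.HodgeConjecture.HodgeConjecture.Cruxes.H413.K2E5QuatAdelicSinglePlace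
open scoped Matrix MatrixGroups

/-! ## §1 Index two: a subgroup containing an index-`2` subgroup and one more element is everything -/

/-- If `H ≤ K`, `H` has index `2` and `K` contains an element outside `H`, then `K = ⊤`. [folklore] -/
theorem sup_eq_top_of_index_two {G : Type*} [Group G] {H K : Subgroup G} (hHK : H ≤ K) (hH : H.index = 2) {q : G} (hqK : q ∈ K) (hqH : q ∉ H) :
    K = ⊤ := by
  have hdvd : K.index ∣ 2 := hH ▸ Subgroup.index_dvd_of_le hHK
  rcases (Nat.dvd_prime Nat.prime_two).1 hdvd with h1 | h2
  · exact Subgroup.index_eq_one.1 h1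
  · exfalso
    have hrel : H.relIndex K = 1 := by
      have h := Subgroup.relIndex_mul_index hHK
      rw [hH, h2] at h
      omega
    exact hqH ((Subgroup.relIndex_eq_one.1 hrel) hqK)

/-! ## §2 A finite place of `L⁺` with a local non-norm from `L` -/

section NonNorm

variable (L : Type) [Field L] [NumberField L] [IsCMField L]

/-- **There is a finite place `v₀` of `L⁺` and a `c ∈ L⁺_{v₀}ˣ` that is NOT a local norm from `L ⊗ L⁺_{v₀}`** (i.e. `c ∉ quadraticNormSubgroup L⁺_{v₀} θ`, `L = L⁺(√θ)`):
Hilbert reciprocity applied to an `a ∈ L⁺` negative at exactly one real place (such `a` exist by sign prescription; at a real place of the totally real `L⁺` the local norms from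
`ℂ` are the positives, `θ` being totally negative). [cite: Omeara1963, §71 Thm. 71:18, 71:19] [cite: PlatonovRapinchuk1994, §1.2] -/
theorem exists_not_mem_quadraticNormSubgroup :
    ∃ (v₀ : HeightOneSpectrum (𝓞 ↥(maximalRealSubfield L))) (c : (v₀.adicCompletion ↥(maximalRealSubfield L))ˣ),
      c ∉ quadraticNormSubgroup (v₀.adicCompletion ↥(maximalRealSubfield L))
        (algebraMap ↥(maximalRealSubfield L) (v₀.adicCompletion ↥(maximalRealSubfield L)) (cmQuadraticGenerator L : ↥(maximalRealSubfield L))) := by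
  classical
  set K := ↥(maximalRealSubfield L) with hK
  set θ : K := (cmQuadraticGenerator L : K) with hθ
  have hθsq : ¬ IsSquare θ := not_isSquare_cmQuadraticGenerator L
  -- a real place `w₀` and an `a ∈ K` negative exactly at `w₀`
  obtain ⟨w₀⟩ : Nonempty (InfinitePlace K) := inferInstance
  have hw₀ : w₀.IsReal := IsTotallyReal.isReal w₀
  obtain ⟨a, ha⟩ := Literature.NumberTheory.NumberFields.exists_forall_embedding_pos_iff K {w | w ≠ ⟨w₀, hw₀⟩}
  have hneg : InfinitePlace.embedding_of_isReal hw₀ a < 0 := (ha ⟨w₀, hw₀⟩).2 (by simp)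
  have hpos : ∀ w : InfinitePlace K, ∀ hw : w.IsReal, w ≠ w₀ → 0 < InfinitePlace.embedding_of_isReal hw a := fun w hw hne =>
    (ha ⟨w, hw⟩).1 (by simpa using hne)
  have ha0 : a ≠ 0 := by
    rintro rfl
    rw [map_zero] at hneg
    exact lt_irrefl _ hneg
  -- the principal idèle `(a)` lies in `P ⊔ N`, so its bad places are even in number
  set i : ideleGroup K := Units.map (algebraMap K (AdeleRing (𝓞 K) K) : K →* AdeleRing (𝓞 K) K) (Units.mk0 a ha0) with hi
  have hiPN : i ∈ principalIdeles K ⊔ normIdeles K θ := Subgroup.mem_sup_left ⟨Units.mk0 a ha0, rfl⟩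
  have heven := (mem_principalIdeles_sup_normIdeles_iff_even hθsq i).1 hiPN
  -- exactly one infinite place is bad
  have hinf : {w : InfinitePlace K | ideleInfiniteComponent K w i ∉ quadraticNormSubgroup w.Completion (algebraMap K w.Completion θ)} = {w₀} := by
    ext w
    have hw : w.IsReal := IsTotallyReal.isReal w
    rw [Set.mem_setOf_eq, Set.mem_singleton_iff, hi, ideleInfiniteComponent_principal, hθ,
      Literature.NumberTheory.Rogawski1990.mem_quadraticNormSubgroup_completion_iff_pos hw, Units.coe_map, MonoidHom.coe_coe, Units.val_mk0,
      ringEquivRealOfIsReal_algebraMap]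
    constructor
    · intro h
      by_contra hne
      exact h (hpos w hw hne)
    · rintro rfl
      exact not_lt.2 hneg.le
  have hodd : ¬ Even {v : HeightOneSpectrum (𝓞 K) | ideleFiniteComponent K v i ∉
      quadraticNormSubgroup (v.adicCompletion K) (algebraMap K (v.adicCompletion K) θ)}.ncard := by
    rw [hinf, Set.ncard_singleton, Nat.even_add_one] at heven
    exact heven
  have hne : {v : HeightOneSpectrum (𝓞 K) | ideleFiniteComponent K v i ∉
      quadraticNormSubgroup (v.adicCompletion K) (algebraMap K (v.adicCompletion K) θ)}.Nonempty :=
    Set.nonempty_of_ncard_ne_zero fun h0 => hodd (by rw [h0]; exact Even.zero)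
  obtain ⟨v₀, hv₀⟩ := hne
  exact ⟨v₀, ideleFiniteComponent K v₀ i, hv₀⟩

end NonNorm

/-! ## §3 Weak approximation -/

section WeakApprox

variable (L : Type) [Field L] [NumberField L] [IsCMField L] (Ha : Matrix (Fin 2) (Fin 2) L)

/-- **A reduced norm outside `P · N`**: there is an idèle `q ∈ Q⁺ = Nrd((D_h⊗𝔸)^×).comap(𝕀_{L⁺} → 𝕀_L)` not in `L⁺ˣ · N_{L/L⁺}(𝕀_L)` — the single-place idèle `⟨c⟩_{v₀}` of §2
(in `Q⁺` by ★ `ideleBaseChange_localUnits_mem_range_quatAdelicNrd`, outside `P·N` by ★ `localUnits_mem_principalIdeles_sup_normIdeles_iff` = O'Meara 71:18).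
[cite: Omeara1963, §71 Thm. 71:18] [cite: VignerasLNM800, Ch. III §2] -/
theorem exists_mem_comap_range_not_mem_sup (hHa : (Ha.map (cmConjRingHom L)).transpose = Ha) (hdet : Ha.det ≠ 0) :
    ∃ q : ideleGroup ↥(maximalRealSubfield L),
      q ∈ ((quatAdelicNrd L Ha).range).comap (AdeleRing.ideleBaseChange (↥(maximalRealSubfield L)) L) ∧
      q ∉ principalIdeles ↥(maximalRealSubfield L) ⊔ normIdeles ↥(maximalRealSubfield L) (cmQuadraticGenerator L : ↥(maximalRealSubfield L)) := by
  obtain ⟨v₀, c, hc⟩ := exists_not_mem_quadraticNormSubgroup L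
  have hθ0 : (cmQuadraticGenerator L : ↥(maximalRealSubfield L)) ≠ 0 := fun h =>
    not_isSquare_cmQuadraticGenerator L (by rw [h]; exact IsSquare.zero)
  refine ⟨localUnits v₀ c, Subgroup.mem_comap.2 (ideleBaseChange_localUnits_mem_range_quatAdelicNrd L Ha hHa hdet v₀ c), fun h => hc ?_⟩
  exact (localUnits_mem_principalIdeles_sup_normIdeles_iff (↥(maximalRealSubfield L)) hθ0 v₀ c).1 h

/-- **WEAK APPROXIMATION FOR THE REDUCED-NORM IMAGE: `L⁺ˣ · Q⁺ = 𝕀_{L⁺}`** — the principal idèles together with the descent `Q⁺` of the image `Nrd((D_h ⊗ 𝔸)^×)` generate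
ALL of `𝕀_{L⁺}` (index-two argument: `P·N ≤ P·Q⁺` with `[𝕀 : P·N] = 2`, ★ `index_principalIdeles_sup_normIdeles`, and §3's witness).  This is the input that makes
`covol(Q⁺ ∕ Nrd Γ_h)` equal to the `h`-free `covol(𝕀¹_{L⁺} ∕ L⁺ˣ)` in socket G6. [cite: Omeara1963, §65D Prop. 65:21] [cite: VignerasLNM800, Ch. III §2 (proof of Thm. 2.3)]
[cite: PlatonovRapinchuk1994, §8.2] -/
theorem principalIdeles_sup_comap_range_quatAdelicNrd_eq_top (hHa : (Ha.map (cmConjRingHom L)).transpose = Ha) (hdet : Ha.det ≠ 0) :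
    principalIdeles ↥(maximalRealSubfield L) ⊔ ((quatAdelicNrd L Ha).range).comap (AdeleRing.ideleBaseChange (↥(maximalRealSubfield L)) L) = ⊤ := by
  obtain ⟨q, hqQ, hqPN⟩ := exists_mem_comap_range_not_mem_sup L Ha hHa hdet
  refine sup_eq_top_of_index_two (sup_le_sup_left (normIdeles_le_comap_range_quatAdelicNrd L Ha hHa hdet) _)
    (index_principalIdeles_sup_normIdeles ↥(maximalRealSubfield L) _ (not_isSquare_cmQuadraticGenerator L)) (Subgroup.mem_sup_right hqQ) hqPN

/-- **Every idèle of `L⁺` is a principal idèle times the descent of a reduced norm**: `∀ t ∈ 𝕀_{L⁺}, ∃ a ∈ L⁺ˣ, ∃ X ∈ (D_h ⊗ 𝔸)^×, t ⊗ 1 = (a ⊗ 1) · Nrd X` (unfolding of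
`principalIdeles_sup_comap_range_quatAdelicNrd_eq_top`). [cite: VignerasLNM800, Ch. III §2] [cite: PlatonovRapinchuk1994, §8.2] -/
theorem exists_principal_mul_quatAdelicNrd_eq (hHa : (Ha.map (cmConjRingHom L)).transpose = Ha) (hdet : Ha.det ≠ 0)
    (t : ideleGroup ↥(maximalRealSubfield L)) :
    ∃ (a : (↥(maximalRealSubfield L))ˣ) (X : ↥(quatAdelicUnits L Ha)),
      AdeleRing.ideleBaseChange (↥(maximalRealSubfield L)) L t =
        AdeleRing.ideleBaseChange (↥(maximalRealSubfield L)) L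
            (Units.map (algebraMap ↥(maximalRealSubfield L) (AdeleRing (𝓞 ↥(maximalRealSubfield L)) ↥(maximalRealSubfield L)) :
              ↥(maximalRealSubfield L) →* AdeleRing (𝓞 ↥(maximalRealSubfield L)) ↥(maximalRealSubfield L)) a) * quatAdelicNrd L Ha X := by
  have ht : t ∈ principalIdeles ↥(maximalRealSubfield L) ⊔ ((quatAdelicNrd L Ha).range).comap (AdeleRing.ideleBaseChange (↥(maximalRealSubfield L)) L) := by
    rw [principalIdeles_sup_comap_range_quatAdelicNrd_eq_top L Ha hHa hdet]
    exact Subgroup.mem_top t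
  obtain ⟨p, hp, q, hq, hpq⟩ := Subgroup.mem_sup.1 ht
  obtain ⟨a, rfl⟩ := hp
  obtain ⟨X, hX⟩ := Subgroup.mem_comap.1 hq
  exact ⟨a, X, by rw [← hpq, map_mul, hX]⟩

/-- **The same in `𝕀_L`**: every `c ⊗ 1`-fixed idèle `t ∈ fixedAdelicUnits L` (★ #3i; `= 𝕀_{L⁺}` by Galois descent) is `(a ⊗ 1) · Nrd X` with `a ∈ L⁺ˣ` and `X ∈ (D_h ⊗ 𝔸)^×` —
the deal's phrasing «every `t : ↥(fixedAdelicUnits L)` is (principal) · (element of the Nrd-image)». [cite: VignerasLNM800, Ch. III §2] [cite: CasselsFrohlichANT1967, Ch. II §14] -/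
theorem exists_principal_mul_quatAdelicNrd_eq_of_mem_fixedAdelicUnits (hHa : (Ha.map (cmConjRingHom L)).transpose = Ha) (hdet : Ha.det ≠ 0)
    {t : (AdeleRing (𝓞 L) L)ˣ} (ht : t ∈ fixedAdelicUnits L) :
    ∃ (a : (↥(maximalRealSubfield L))ˣ) (X : ↥(quatAdelicUnits L Ha)),
      t = Units.map (algebraMap L (AdeleRing (𝓞 L) L) : L →* AdeleRing (𝓞 L) L)
            (Units.map (algebraMap ↥(maximalRealSubfield L) L : ↥(maximalRealSubfield L) →* L) a) * quatAdelicNrd L Ha X := by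
  rw [fixedAdelicUnits_eq_range_ideleBaseChange] at ht
  obtain ⟨s, rfl⟩ := ht
  obtain ⟨a, X, h⟩ := exists_principal_mul_quatAdelicNrd_eq L Ha hHa hdet s
  refine ⟨a, X, h.trans ?_⟩
  congr 1
  refine Units.ext ?_
  rw [AdeleRing.coe_ideleBaseChange, Units.coe_map, MonoidHom.coe_coe, AdeleRing.baseChange_algebraMap, Units.coe_map, MonoidHom.coe_coe, Units.coe_map,
    MonoidHom.coe_coe]

end WeakApprox

end Summit.HodgeConjecture.HodgeConjecture.Cruxes.H413.K2E5QuatNrdWeakApproximation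

end
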